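import Summits.QuantumFields.YangMills.Theorems.BalabanUVNodesPortS1JacobianHoloCov

/-!
# NODE O port PT-A — THE RESPONSE OF THE HOLOMORPHIC (0.4) AVERAGE IS GAUGE COVARIANT: for det-one `u`, `D avgMh(W^u)[v^u](c) = u(emb c₋) · D avgMh(W)[v](c) · adj u(emb c₊)` for EVERY direction
# `v` — the action `X ↦ (b ↦ u(b₋)·X(b)·adj u(b₊))` is LINEAR, `avgMh` intertwines it with conjugation for all fields (✓p812912 `avgMh_gauge`), so the two chain rules for `X ↦ avgMh(X^u)(c)` at `W`
# give the same derivative (the derivative-level half of row (d) of `stub_LZjac`; the block law `A₁^ℂ(c)(W^u) = Ad^ℂ(u(c₋))·A₁^ℂ(c)(W)·Ad^ℂ(adj u(b₀(c)₋))` is its coordinate reading — gen 6)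

Cell `ym-nodeO-ideate`, porter seat `ymgap-nodeO-port-PTA-1` (gen 5); `--supports stmt-QuantumFields-27930` (helper; registered stub `stub_LZjac`, PORT-PLAN-v5 §4 row (d)).  [I] = [Balaban1987RG1].
CONSUMED BY NAME: ✓p812912 (`avgMh_gauge`), `B15AveragingHolomorphic.differentiableAt_avgMh`, Mathlib (`LinearMap.toContinuousLinearMap`, `HasFDerivAt.comp ∕ .unique`, `ContinuousLinearMap.mul`).
* `exists_gaugeCLM` (the action as a continuous ℂ-linear map), ★★ `fderiv_avgMh_gauge`.

HONEST FRAMING.  Calculus over the tree's holomorphic model; both polydisc conditions (at `W` and at `W^u`) are DISPLAYED hypotheses (non-unitary conjugation does not preserve the polydisc); NOTHING of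
Bałaban asserted; `stub_LZjac` OPEN; `stub_LZdet` BLOCKED-ON P0 (α)+(β); `stub_FE` XXL; 27930 OPEN · no claim; K0⁷∕K-Ax OPEN; NODE O 0∕1; COUNT 8∕28 · K 1∕4 UNMOVED; finite `𝕋⁴_{L^K}` at fixed ε —
NOT continuum ∕ OS ∕ Clay; **the Yang–Mills mass gap is NOT proved by any of this.**  No `sorry`, no `def`, no `instance`, no `notation`; standard axioms.
-/

noncomputable section

open scoped BigOperators Matrix.Norms.L2Operator Topology

namespace Summit.QuantumFields.YangMills.Theorems.BalabanUVNodesPortS1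

open Summit.QuantumFields.YangMills.Theorems.K0RecordFormatNames
open Literature.MathematicalPhysics.QuantumFieldTheory.Balaban1983to89
open Literature.MathematicalPhysics.QuantumFieldTheory.Balaban1983to89.Node00
open Literature.MathematicalPhysics.QuantumFieldTheory.Balaban1983to89.T4Continuum (T4Family)
open Literature.MathematicalPhysics.QuantumFieldTheory.Balaban1983to89.BlockAveraging (Idx)
open Literature.MathematicalPhysics.QuantumFieldTheory.Balaban1983to89.BlockAveragingHaarAC (centralBond)
open Literature.MathematicalPhysics.QuantumFieldTheory.Balaban1983to89.B15AveragingHolomorphic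
open _root_.Matrix _root_.Filter

variable {P : Params} {j : ℕ}

/-! ## §1  The transformation `W ↦ (b ↦ u(b₋)·W(b)·adj u(b₊))` is linear; the average intertwines it with conjugation; hence the DERIVATIVE is covariant -/

/-- The det-one gauge action on matrix fields as a continuous ℂ-linear map exists (with the stated action). [cite: Balaban1987RG1, (1.10) p.262 (bookkeeping)] -/
theorem exists_gaugeCLM (u : Site P j → MatA 2) :
    ∃ T : (PBond P j → MatA 2) →L[ℂ] (PBond P j → MatA 2), ∀ (X : PBond P j → MatA 2) (b : PBond P j), T X b = u b.src * X b * (u b.tgt).adjugate := by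
  let Tlin : (PBond P j → MatA 2) →ₗ[ℂ] (PBond P j → MatA 2) :=
    { toFun := fun X b => u b.src * X b * (u b.tgt).adjugate
      map_add' := fun X Y => by funext b; simp only [Pi.add_apply, mul_add, add_mul]
      map_smul' := fun z X => by funext b; simp only [Pi.smul_apply, RingHom.id_apply, Matrix.mul_smul, Matrix.smul_mul] }
  exact ⟨LinearMap.toContinuousLinearMap Tlin, fun X b => rfl⟩

/-- ★★ **THE RESPONSE OF THE HOLOMORPHIC AVERAGE IS GAUGE COVARIANT**: for det-one `u`, a field `W` and its transform `W^u` both with loop matrices in the unit polydisc, and ANY direction `v`,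
`D avgMh(W^u)[v^u](c) = u(emb c₋) · D avgMh(W)[v](c) · adj u(emb c₊)` (the average intertwines the LINEAR action with conjugation, `avgMh_gauge`, for all fields; differentiate).
[cite: Balaban1987RG1, (0.6) p.253, (1.10) p.262, (2.16) p.269] -/
theorem fderiv_avgMh_gauge (u : Site P j → MatA 2) (hu : ∀ x, (u x).det = 1) (W : PBond P j → MatA 2)
    (h : ∀ (c : PBond P (j + 1)) (i : Idx P), ‖loopMh W c i - 1‖ < 1)
    (h' : ∀ (c : PBond P (j + 1)) (i : Idx P), ‖loopMh (fun b : PBond P j => u b.src * W b * (u b.tgt).adjugate) c i - 1‖ < 1)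
    (v : PBond P j → MatA 2) (c : PBond P (j + 1)) :
    fderiv ℂ (avgMh : (PBond P j → MatA 2) → PBond P (j + 1) → MatA 2) (fun b : PBond P j => u b.src * W b * (u b.tgt).adjugate)
        (fun b : PBond P j => u b.src * v b * (u b.tgt).adjugate) c =
      u (emb c.src) * fderiv ℂ (avgMh : (PBond P j → MatA 2) → PBond P (j + 1) → MatA 2) W v c * (u (emb c.tgt)).adjugate := by
  obtain ⟨T, hT⟩ := exists_gaugeCLM u
  have hTfun : ∀ X : PBond P j → MatA 2, T X = fun b => u b.src * X b * (u b.tgt).adjugate := fun X => funext fun b => hT X b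
  -- the conjugation on the coarse field at `c`, as a continuous linear map
  let Φ : MatA 2 →L[ℂ] MatA 2 := (ContinuousLinearMap.mul ℂ (MatA 2) (u (emb c.src))).comp ((ContinuousLinearMap.mul ℂ (MatA 2)).flip ((u (emb c.tgt)).adjugate))
  have hΦ : ∀ M : MatA 2, Φ M = u (emb c.src) * M * (u (emb c.tgt)).adjugate := fun M => by
    show u (emb c.src) * (M * (u (emb c.tgt)).adjugate) = _
    rw [mul_assoc]
  -- the two ways to differentiate `X ↦ avgMh (T X) c` at `W`
  have hcomp_fun : (fun X : PBond P j → MatA 2 => avgMh (T X) c) = fun X => Φ (avgMh X c) := by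
    funext X
    rw [hTfun X, avgMh_gauge u hu X c, hΦ]
  have hDT : HasFDerivAt (fun X : PBond P j → MatA 2 => avgMh (T X) c)
      (((ContinuousLinearMap.proj c).comp (fderiv ℂ (avgMh : (PBond P j → MatA 2) → PBond P (j + 1) → MatA 2) (T W))).comp T) W := by
    have hA : HasFDerivAt (avgMh : (PBond P j → MatA 2) → PBond P (j + 1) → MatA 2)
        (fderiv ℂ (avgMh : (PBond P j → MatA 2) → PBond P (j + 1) → MatA 2) (T W)) (T W) := by
      have hpoly : ∀ (c' : PBond P (j + 1)) (i : Idx P), ‖loopMh (T W) c' i - 1‖ < 1 := by rw [hTfun W]; exact h'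
      exact (differentiableAt_avgMh hpoly).hasFDerivAt
    have hAc : HasFDerivAt (fun X : PBond P j → MatA 2 => avgMh X c)
        ((ContinuousLinearMap.proj c).comp (fderiv ℂ (avgMh : (PBond P j → MatA 2) → PBond P (j + 1) → MatA 2) (T W))) (T W) :=
      (hasFDerivAt_pi'.mp hA) c
    exact hAc.comp W T.hasFDerivAt
  have hDΦ : HasFDerivAt (fun X : PBond P j → MatA 2 => Φ (avgMh X c))
      (Φ.comp ((ContinuousLinearMap.proj c).comp (fderiv ℂ (avgMh : (PBond P j → MatA 2) → PBond P (j + 1) → MatA 2) W))) W := by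
    have hA : HasFDerivAt (avgMh : (PBond P j → MatA 2) → PBond P (j + 1) → MatA 2)
        (fderiv ℂ (avgMh : (PBond P j → MatA 2) → PBond P (j + 1) → MatA 2) W) W := (differentiableAt_avgMh h).hasFDerivAt
    exact Φ.hasFDerivAt.comp W ((hasFDerivAt_pi'.mp hA) c)
  rw [hcomp_fun] at hDT
  have heq := hDT.unique hDΦ
  have happ := congrArg (fun L : (PBond P j → MatA 2) →L[ℂ] MatA 2 => L v) heq
  simp only [ContinuousLinearMap.coe_comp, Function.comp_apply, ContinuousLinearMap.proj_apply, hΦ] at happ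
  rw [hTfun v, hTfun W] at happ
  exact happ

end Summit.QuantumFields.YangMills.Theorems.BalabanUVNodesPortS1

end
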